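import Literature.AlgebraicGeometry.Frobenioids.NumberFieldLocalizationCategories
import Literature.AlgebraicGeometry.Frobenioids.NumberFieldLocalizationCategoriesProofs
import Literature.AlgebraicGeometry.Frobenioids.BCatOrbits
import Literature.AlgebraicGeometry.Frobenioids.Dissection
import Mathlib.Algebra.Group.TypeTags.Finite
import Mathlib.Data.Fintype.Prod
import Mathlib.Tactic.FinCases
import HarnessLib

/-!
# Frobenioids II, Example 1.4 (iii): the printed strongly-indissectible clause fails at `(V₄, 1)`

W-12 kernel witness (FLAG #12, RULING E14-iii): for `G = ℤ/2 × ℤ/2` (discrete, hence profinite) and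
`D = 1` — arithmetically `(Gal(ℚ(√2,√3)/ℚ), D_v)` for `v = 23` totally split — the named statement
`NFLocCat.ApplicationToPadicFrobenioids G D` ([FrdII] Ex. 1.4 (iii) p. 13, typed AS PRINTED in
`NumberFieldLocalizationCategories.lean`) is FALSE: with `P := P₀`, `Φ := 𝟭`, the category `P₀ = B(1)⁰`
has only initial objects (so it is vacuously of strongly indissectible type), while in
`E = P₀ ×_{P₀} E₀` the object over `Q = G/G` is weakly dissected by the two objects over `G/A`, `G/B`
(`A`, `B` the two coordinate subgroups): a non-initial common source would have a free `Q`-part, and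
objects of `E` with free `Q`-part are initial.  This is the degenerate case of Prop. 1.5 (vii) recorded in
`NFLoc.dissectible_iff_fst`; the repaired statement is `ApplicationToPadicFrobenioidsRepaired`.
Recorded neutrally (erratum-class flag); no side is taken on the intended reading.
[cite: MochizukiFrdII2008, Ex. 1.4 (iii) p.13]
-/

namespace Literature.AlgebraicGeometry.Frobenioids

namespace NFLocCat

open CategoryTheory CategoryTheory.Limits

open scoped FintypeCatDiscrete

section PZero

variable {G : Type} [Group G] [TopologicalSpace G] [IsTopologicalGroup G]

/-- In `P₀ = B(1)⁰` (connected objects for the TRIVIAL subgroup) every object has exactly one point.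
[cite: MochizukiFrdII2008, Ex. 1.4 (i) p.12] -/
theorem pt_eq (X : PCat G (⊥ : Subgroup G)) (x y : X.obj.obj.V) : x = y := by
  obtain ⟨d, hd⟩ := BCat.exists_smul_eq_of_isConnectedObj X.obj X.property x y
  have hd1 : d = 1 := Subtype.ext ((Subgroup.mem_bot).mp d.2)
  rw [hd1, one_smul] at hd
  exact hd

omit [IsTopologicalGroup G] in
/-- Every object of `P₀ = B(1)⁰` has a point. [cite: MochizukiFrdII2008, Ex. 1.4 (i) p.12] -/
theorem pt_nonempty (X : PCat G (⊥ : Subgroup G)) : Nonempty X.obj.obj.V :=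
  BCat.nonempty_of_isNonemptyObj _ X.property.1

/-- Any two objects of `P₀ = B(1)⁰` are joined by a morphism. [cite: MochizukiFrdII2008, Ex. 1.4 (i) p.12] -/
theorem nonempty_ptHom (X Y : PCat G (⊥ : Subgroup G)) : Nonempty (X ⟶ Y) :=
  ⟨ObjectProperty.homMk (ObjectProperty.homMk
    { hom := FintypeCat.homMk fun _ => (pt_nonempty Y).some
      comm := fun _ => FintypeCat.hom_ext _ _ fun _ => pt_eq Y _ _ })⟩

/-- Morphisms of `P₀ = B(1)⁰` are unique. [cite: MochizukiFrdII2008, Ex. 1.4 (i) p.12] -/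
theorem ptHom_unique {X Y : PCat G (⊥ : Subgroup G)} (f g : X ⟶ Y) : f = g :=
  ObjectProperty.hom_ext _ (BCat.hom_ext_apply fun _ => pt_eq Y _ _)

/-- Every object of `P₀ = B(1)⁰` is initial. [cite: MochizukiFrdII2008, Ex. 1.4 (i) p.12] -/
theorem isInitial_pt (X : PCat G (⊥ : Subgroup G)) : Nonempty (IsInitial X) :=
  ⟨IsInitial.ofUniqueHom (fun Y => (nonempty_ptHom X Y).some) fun _ _ => ptHom_unique _ _⟩

/-- `P₀ = B(1)⁰` is connected. [cite: MochizukiFrdII2008, Ex. 1.4 (ii) p.13] -/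
theorem isConnected_PCat_bot : IsConnected (PCat G (⊥ : Subgroup G)) := by
  obtain ⟨T, -, hT, -⟩ := exists_point_obj (↥(⊥ : Subgroup G))
  haveI : Nonempty (PCat G (⊥ : Subgroup G)) := ⟨⟨T, hT⟩⟩
  exact zigzag_isConnected fun X Y => Zigzag.of_hom (nonempty_ptHom X Y).some

/-- `P₀ = B(1)⁰` is (vacuously) of strongly indissectible type: it has no non-initial object.
[cite: MochizukiFrdII2008, Ex. 1.4 (iii) p.13] -/
theorem isOfStronglyIndissectibleType_PCat_bot :
    IsOfStronglyIndissectibleType (PCat G (⊥ : Subgroup G)) :=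
  ⟨fun _ ⟨X, _, hne, _⟩ => (hne 0).false (isInitial_pt (X 0)).some⟩

end PZero

section BCatLemmas

variable {G : Type} [Group G] [TopologicalSpace G]

/-- Stabilisers grow along equivariant maps. [cite: MochizukiFrdI2008, §0 p.13] -/
theorem stabilizer_le_of_hom {X Y : BCat G} (f : X ⟶ Y) (x : X.obj.V) :
    MulAction.stabilizer G x ≤ MulAction.stabilizer G (f.hom.hom x) := by
  intro g hg
  rw [MulAction.mem_stabilizer_iff] at hg ⊢
  rw [← BCat.hom_smul, hg]

/-- A free transitive object of `B(G)` maps to any object through any prescribed point.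
[cite: MochizukiFrdI2008, §0 p.13] -/
theorem exists_hom_of_free (X Y : BCat G) (x₀ : X.obj.V) (htr : ∀ x : X.obj.V, ∃ g : G, g • x₀ = x)
    (hfree : MulAction.stabilizer G x₀ = ⊥) (y : Y.obj.V) :
    ∃ f : X ⟶ Y, f.hom.hom x₀ = y := by
  classical
  choose c hc using htr
  -- `c x • x₀ = x`; freeness makes `c` equivariant up to the (trivial) stabiliser
  have key : ∀ (g : G) (x : X.obj.V), c (g • x) = g * c x := by
    intro g x
    have e : c (g • x) • x₀ = (g * c x) • x₀ := by rw [hc, mul_smul, hc]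
    have h1 : ((g * c x)⁻¹ * c (g • x)) • x₀ = x₀ := by
      rw [mul_smul, e, ← mul_smul, inv_mul_cancel, one_smul]
    have h2 : (g * c x)⁻¹ * c (g • x) ∈ MulAction.stabilizer G x₀ :=
      MulAction.mem_stabilizer_iff.mpr h1
    rw [hfree, Subgroup.mem_bot] at h2
    exact (inv_mul_eq_one.mp h2).symm
  refine ⟨ObjectProperty.homMk
    { hom := FintypeCat.homMk fun x => c x • y
      comm := fun g => FintypeCat.hom_ext _ _ fun x => ?_ }, ?_⟩
  · change c (g • x) • y = g • (c x • y)
    rw [key, mul_smul]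
  · change c x₀ • y = y
    have h0 : c x₀ ∈ MulAction.stabilizer G x₀ := MulAction.mem_stabilizer_iff.mpr (hc x₀)
    rw [hfree, Subgroup.mem_bot] at h0
    rw [h0, one_smul]

end BCatLemmas

/-! ### The witness -/

/-- For `G = ℤ/2 × ℤ/2` (discrete) and `D = 1`, the statement `ApplicationToPadicFrobenioids G D`
typed AS PRINTED is false (its fifth conjunct fails for `P := P₀`, `Φ := 𝟭`).
[cite: MochizukiFrdII2008, Ex. 1.4 (iii) p.13] -/
theorem not_applicationToPadicFrobenioids_klein_four :
    ¬ @ApplicationToPadicFrobenioids.{0, 1, 0} (Multiplicative (ZMod 2) × Multiplicative (ZMod 2)) _ ⊥ (⊥ : Subgroup (Multiplicative (ZMod 2) × Multiplicative (ZMod 2))) := by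
  letI : TopologicalSpace (Multiplicative (ZMod 2) × Multiplicative (ZMod 2)) := ⊥
  haveI : DiscreteTopology (Multiplicative (ZMod 2) × Multiplicative (ZMod 2)) := ⟨rfl⟩
  haveI : IsTopologicalGroup (Multiplicative (ZMod 2) × Multiplicative (ZMod 2)) :=
    { continuous_mul := continuous_of_discreteTopology
      continuous_inv := continuous_of_discreteTopology }
  intro h
  let D : Subgroup (Multiplicative (ZMod 2) × Multiplicative (ZMod 2)) := ⊥
  have h5 := (h (𝟭 (PCat (Multiplicative (ZMod 2) × Multiplicative (ZMod 2)) D)) (𝟭 (PCat (Multiplicative (ZMod 2) × Multiplicative (ZMod 2)) D)) isConnected_PCat_bot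
    (isTotallyEpimorphic_connectedPart (↥D))).2.2.2.2 isOfStronglyIndissectibleType_PCat_bot
  -- the two coordinate subgroups `A`, `B` and their basic properties
  let A : Subgroup (Multiplicative (ZMod 2) × Multiplicative (ZMod 2)) := (MonoidHom.snd (Multiplicative (ZMod 2)) (Multiplicative (ZMod 2))).ker
  let B : Subgroup (Multiplicative (ZMod 2) × Multiplicative (ZMod 2)) := (MonoidHom.fst (Multiplicative (ZMod 2)) (Multiplicative (ZMod 2))).ker
  have hAB : A ⊓ B = ⊥ := by
    refine le_antisymm (fun g hg => ?_) bot_le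
    rw [Subgroup.mem_bot]
    exact Prod.ext hg.2 hg.1
  let a : (Multiplicative (ZMod 2) × Multiplicative (ZMod 2)) := (Multiplicative.ofAdd 1, 1)
  have haA : a ∈ A := rfl
  have ha1 : a ≠ 1 := by decide
  -- coset objects `G/A`, `G/B`, `G/1` and the one-point objects
  obtain ⟨QA, qA, hstA, htrA, hmapA⟩ := BCat.exists_coset_obj (G := (Multiplicative (ZMod 2) × Multiplicative (ZMod 2))) A (isOpen_discrete _)
  obtain ⟨QB, qB, hstB, htrB, hmapB⟩ := BCat.exists_coset_obj (G := (Multiplicative (ZMod 2) × Multiplicative (ZMod 2))) B (isOpen_discrete _)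
  obtain ⟨QF, qF, hstF, htrF, -⟩ := BCat.exists_coset_obj (G := (Multiplicative (ZMod 2) × Multiplicative (ZMod 2))) (⊥ : Subgroup (Multiplicative (ZMod 2) × Multiplicative (ZMod 2))) (isOpen_discrete _)
  obtain ⟨QT, qT, hQT, hqT⟩ := exists_point_obj (Multiplicative (ZMod 2) × Multiplicative (ZMod 2))
  obtain ⟨PT, pT, hPT, hpT⟩ := exists_point_obj (↥D)
  -- stabilisers in `G/A`, `G/B` are `A`, `B` (abelian group), in `G/1` trivial
  have stab_le : ∀ (U : Subgroup (Multiplicative (ZMod 2) × Multiplicative (ZMod 2))) (Q : BCat (Multiplicative (ZMod 2) × Multiplicative (ZMod 2))) (q₀ : Q.obj.V), MulAction.stabilizer (Multiplicative (ZMod 2) × Multiplicative (ZMod 2)) q₀ = U →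
      (∀ q : Q.obj.V, ∃ g : (Multiplicative (ZMod 2) × Multiplicative (ZMod 2)), g • q₀ = q) → ∀ q : Q.obj.V, MulAction.stabilizer (Multiplicative (ZMod 2) × Multiplicative (ZMod 2)) q ≤ U := by
    intro U Q q₀ hst htr q k hk
    obtain ⟨g, rfl⟩ := htr q
    rw [MulAction.mem_stabilizer_iff, ← mul_smul, mul_comm, mul_smul] at hk
    have hk' : k • q₀ = q₀ := smul_left_cancel g hk
    rw [← hst]
    exact hk'
  -- the objects `T_U = (pt, Q_U, ι_U)` of `E₀` and `X_U = (pt, T_U, refl)` of `E`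
  let mkι : ∀ (Q : BCat (Multiplicative (ZMod 2) × Multiplicative (ZMod 2))) (q : Q.obj.V), (PT ⟶ (res (Multiplicative (ZMod 2) × Multiplicative (ZMod 2)) D).obj Q) := fun Q q =>
    ObjectProperty.homMk
      { hom := FintypeCat.homMk fun _ => (q : ((res (Multiplicative (ZMod 2) × Multiplicative (ZMod 2)) D).obj Q).obj.V)
        comm := fun d => FintypeCat.hom_ext _ _ fun _ => by
          have hd : d = 1 := Subtype.ext ((Subgroup.mem_bot).mp d.2)
          subst hd
          change q = ((1 : ↥D) : (Multiplicative (ZMod 2) × Multiplicative (ZMod 2))) • q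
          rw [OneMemClass.coe_one, one_smul] }
  have hmono : ∀ (Q : BCat (Multiplicative (ZMod 2) × Multiplicative (ZMod 2))) (q : Q.obj.V), Mono (mkι Q q) := fun Q q =>
    BCat.mono_of_injective _ fun x y _ => (hpT x).trans (hpT y).symm
  let mkT : ∀ (Q : BCat (Multiplicative (ZMod 2) × Multiplicative (ZMod 2))) (q : Q.obj.V), IsConnectedObj Q → ECat (Multiplicative (ZMod 2) × Multiplicative (ZMod 2)) D := fun Q q hQ =>
    ⟨⟨⟨PT, hPT⟩, ⟨Q, hQ⟩, mkι Q q⟩, hmono Q q⟩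
  let E := CFP (𝟭 (PCat (Multiplicative (ZMod 2) × Multiplicative (ZMod 2)) D)) (toP₀ (Multiplicative (ZMod 2) × Multiplicative (ZMod 2)) D)
  let mkX : ∀ (Q : BCat (Multiplicative (ZMod 2) × Multiplicative (ZMod 2))) (q : Q.obj.V), IsConnectedObj Q → E := fun Q q hQ =>
    ⟨⟨PT, hPT⟩, mkT Q q hQ, Iso.refl _⟩
  have hQA : IsConnectedObj QA := BCat.isConnectedObj_of_transitive QA qA htrA
  have hQB : IsConnectedObj QB := BCat.isConnectedObj_of_transitive QB qB htrB
  have hQF : IsConnectedObj QF := BCat.isConnectedObj_of_transitive QF qF htrF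
  let XA : E := mkX QA qA hQA
  let XB : E := mkX QB qB hQB
  let XF : E := mkX QF qF hQF
  let XT : E := mkX QT qT hQT
  -- the arrows `X_U → X_⊤`
  let toT : ∀ (Q : BCat (Multiplicative (ZMod 2) × Multiplicative (ZMod 2))) (q : Q.obj.V) (hQ : IsConnectedObj Q), (mkX Q q hQ ⟶ XT) := fun Q q hQ =>
    { fst := 𝟙 _
      snd := ObjectProperty.homMk
        { left := 𝟙 _
          right := ObjectProperty.homMk (ObjectProperty.homMk
            { hom := FintypeCat.homMk fun _ => qT
              comm := fun _ => FintypeCat.hom_ext _ _ fun _ => (hqT _).symm })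
          w := BCat.hom_ext_apply fun _ => (hqT _).trans (hqT _).symm }
      w := ptHom_unique _ _ }
  -- (1) `X_A`, `X_B` are non-initial: a map `X_A → X_1` would force `A ⊆ Stab = 1`
  have nonempty_of : ∀ (Q : BCat (Multiplicative (ZMod 2) × Multiplicative (ZMod 2))) (q : Q.obj.V) (hQ : IsConnectedObj Q) (g : (Multiplicative (ZMod 2) × Multiplicative (ZMod 2))), g ≠ 1 →
      g ∈ MulAction.stabilizer (Multiplicative (ZMod 2) × Multiplicative (ZMod 2)) q → IsNonemptyObj (mkX Q q hQ) := by
    intro Q q hQ g hg1 hgq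
    refine ⟨fun hI => hg1 ?_⟩
    let k := hI.to XF
    have h1 := stabilizer_le_of_hom k.snd.hom.right.hom q hgq
    have h2 := stab_le ⊥ QF qF hstF htrF _ h1
    rwa [Subgroup.mem_bot] at h2
  have hXA : IsNonemptyObj XA := nonempty_of QA qA hQA a ha1 (by rw [hstA]; exact haA)
  let b : (Multiplicative (ZMod 2) × Multiplicative (ZMod 2)) := (1, Multiplicative.ofAdd 1)
  have hbB : b ∈ B := rfl
  have hb1 : b ≠ 1 := by decide
  have hXB : IsNonemptyObj XB := nonempty_of QB qB hQB b hb1 (by rw [hstB]; exact hbB)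
  -- (2) an object of `E` mapping to both `X_A` and `X_B` has free `Q`-part, hence is initial
  have key : ∀ (Y₀ : E), (Y₀ ⟶ XA) → (Y₀ ⟶ XB) → ¬ IsNonemptyObj Y₀ := by
    intro Y₀ fA fB hY₀
    apply hY₀.false
    let p₀ := (nonempty_left D Y₀.snd).some
    let q₀ : Y₀.snd.obj.right.obj.obj.V := Y₀.snd.obj.hom.hom.hom p₀
    have hQc : IsConnectedObj Y₀.snd.obj.right.obj := Y₀.snd.obj.right.property
    have htr₀ : ∀ z : Y₀.snd.obj.right.obj.obj.V, ∃ g : (Multiplicative (ZMod 2) × Multiplicative (ZMod 2)), g • q₀ = z := fun z =>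
      BCat.exists_smul_eq_of_isConnectedObj _ hQc q₀ z
    have hfree : MulAction.stabilizer (Multiplicative (ZMod 2) × Multiplicative (ZMod 2)) q₀ = ⊥ := by
      refine le_antisymm ?_ bot_le
      rw [← hAB]
      exact le_inf
        ((stabilizer_le_of_hom fA.snd.hom.right.hom q₀).trans (stab_le A QA qA hstA htrA _))
        ((stabilizer_le_of_hom fB.snd.hom.right.hom q₀).trans (stab_le B QB qB hstB htrB _))
    refine IsInitial.ofUniqueHom (fun Y => ?_) (fun Y m => ?_)
    · -- existence of a morphism `Y₀ → Y`
      let pY := (nonempty_left D Y.snd).some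
      let y : Y.snd.obj.right.obj.obj.V := Y.snd.obj.hom.hom.hom pY
      let hr := exists_hom_of_free Y₀.snd.obj.right.obj Y.snd.obj.right.obj q₀ htr₀ hfree y
      refine
        { fst := (nonempty_ptHom _ _).some
          snd := ObjectProperty.homMk
            { left := (nonempty_ptHom _ _).some
              right := ObjectProperty.homMk hr.choose
              w := BCat.hom_ext_apply fun p => ?_ }
          w := ptHom_unique _ _ }
      have hp : p = p₀ := pt_eq Y₀.snd.obj.left p p₀
      rw [hp]
      change Y.snd.obj.hom.hom.hom
          ((nonempty_ptHom Y₀.snd.obj.left Y.snd.obj.left).some.hom.hom.hom p₀) = hr.choose.hom.hom q₀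
      rw [hr.choose_spec]
      exact congrArg _ (pt_eq Y.snd.obj.left _ _)
    · exact CFP.hom_ext (ptHom_unique _ _) (hom_eq_of_left_eq D (ptHom_unique _ _))
  -- (3) `X_⊤` is weakly dissected by `X_A`, `X_B`
  let Xs : Fin 2 → E := fun i => match i with | 0 => XA | 1 => XB
  let φs : ∀ i, Xs i ⟶ XT := fun i => match i with | 0 => toT QA qA hQA | 1 => toT QB qB hQB
  refine h5.isStronglyIndissectible XT ⟨Xs, φs, ?_, ?_⟩
  · intro i
    fin_cases i
    · exact hXA
    · exact hXB
  · intro i j hij Y₀ hY₀ ψi ψj _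
    fin_cases i <;> fin_cases j
    · exact (hij rfl).elim
    · exact key Y₀ ψi ψj hY₀
    · exact key Y₀ ψj ψi hY₀
    · exact (hij rfl).elim

/-- Hence the schema `ApplicationToPadicFrobenioids` is not valid over all profinite pairs `(G, D)` — it
fails at the finite discrete pair `(ℤ/2 × ℤ/2, 1)`, realised arithmetically by
`(Gal(ℚ(√2,√3)/ℚ), D_{23})`. [cite: MochizukiFrdII2008, Ex. 1.4 (iii) p.13] -/
theorem exists_profinite_not_applicationToPadicFrobenioids :
    ∃ (G : Type) (_ : Group G) (_ : TopologicalSpace G) (_ : IsTopologicalGroup G) (_ : CompactSpace G)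
      (_ : TotallyDisconnectedSpace G) (D : Subgroup G), ¬ ApplicationToPadicFrobenioids.{0, 1, 0} G D := by
  letI : TopologicalSpace (Multiplicative (ZMod 2) × Multiplicative (ZMod 2)) := ⊥
  haveI : DiscreteTopology (Multiplicative (ZMod 2) × Multiplicative (ZMod 2)) := ⟨rfl⟩
  haveI : IsTopologicalGroup (Multiplicative (ZMod 2) × Multiplicative (ZMod 2)) :=
    { continuous_mul := continuous_of_discreteTopology
      continuous_inv := continuous_of_discreteTopology }
  exact ⟨(Multiplicative (ZMod 2) × Multiplicative (ZMod 2)), inferInstance, ⊥, inferInstance, inferInstance, inferInstance, ⊥,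
    not_applicationToPadicFrobenioids_klein_four⟩

end NFLocCat

end Literature.AlgebraicGeometry.Frobenioids
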